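import Literature.NumberTheory.LFunctions.RudnickSarnakNKernel
import Literature.NumberTheory.LFunctions.WeilExplicitFormulaProofs
import Literature.NumberTheory.LFunctions.ZetaOrdinateDictionary
import Literature.NumberTheory.LFunctions.MontgomeryZeroSideProofs
import Literature.Analysis.SpecialFunctions.DigammaVerticalSeries
import HarnessLib

/-!
# Rudnick–Sarnak `n`-level correlations for `ζ`, II: the explicit formula in one slot

Sibling file of `Literature/NumberTheory/LFunctions/RudnickSarnak.lean` (toward the named fact
`Literature.NumberTheory.LFunctions.rudnick_sarnak_unrestricted`, Rudnick–Sarnak 1996, Theorem 3.2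
for `ζ`, at every level). Second file of the general-level machinery (kernel:
`RudnickSarnakNKernel.lean`).

## What is proved

For a frequency `a ∈ ℝ` (`x = e^a` in Rudnick–Sarnak's notation) and a centre `t ∈ ℝ`, the
function `u ↦ g₀(u − a) e^{−itu}` (`RudnickSarnakN.slotFn a t`) is a Weil test function whose
transform on the critical line is `ĝ(1/2 + iy) = e^{i(y−t)a} κ(y − t)`
(`RudnickSarnakN.weilMellin_slotFn`). Feeding it to the PROVED Guinand–Weil explicit formula
(`Literature.NumberTheory.LFunctions.explicit_formula_holds`; Rudnick–Sarnak 1996, Prop. 2.1 is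
the same formula) and passing from the zero set to the ordinates `γ_n = zetaOrdinate n` under RH
(`tsum_nontrivialZeros_eq_tsum_zetaOrdinate`) gives the windowed sum over zeros

  `S⁺(a, t) + S⁻(a, t) := Σ_n [e^{iaγ_n} κ(t − γ_n) + e^{−iaγ_n} κ(t + γ_n)]`
  `= e^{−a/2} ĝ₀(−it) + e^{a/2} ĝ₀(1 − it) + e^{iat} (𝒟(a, t) − 𝒜(a, t))`

(`RudnickSarnakN.zeroSumPlus_add_zeroSumMinus`), where

* `𝒜(a, t) = Σ_n Λ(n) n^{−1/2} [g₀(log n − a) n^{−it} + g₀(log n + a) n^{it}]`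
  (`RudnickSarnakN.primePoly`; a finite Dirichlet polynomial, RS (3.14)–(3.15)),
* `𝒟(a, t) = (1/2π) ∫ e^{ias} κ(s) Re ψ(1/4 + i(s + t)/2) ds − g₀(a) log π`
  (`RudnickSarnakN.archTerm`; the archimedean term, RS (3.16)–(3.18) with `g_T`),
* the two polar terms come from `ĝ(0)` and `ĝ(1)` (RS (3.13)).

This is Rudnick–Sarnak's decomposition `S(ξ) = S^+ + S^- + (polar) + (arch)` ((3.12)–(3.18),
p. 287) of one factor of the `n`-fold product, in the `t`-windowed form used by the later files.

## References

* Z. Rudnick, P. Sarnak, *Zeros of principal `L`-functions and random matrix theory*, Duke Math.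
  J. 81 (1996), 269–322, Prop. 2.1 and §3, (3.12)–(3.18).
* H. L. Montgomery, *The pair correlation of zeros of the zeta function* (1973), §2.
-/

noncomputable section

open Complex Filter Set MeasureTheory
open scoped Real Topology ComplexConjugate ArithmeticFunction.vonMangoldt ContDiff

namespace Literature.NumberTheory.LFunctions

namespace RudnickSarnakN

open Literature.Analysis.SpecialFunctions (reDigammaQuarter)
open Montgomery (exists_density_le)

/-! ## The slot test function `u ↦ g₀(u − a) e^{−itu}` -/

/-- The test function attached to the frequency `a` (`x = e^a`) and the centre `t`:
`g_{a,t}(u) := g₀(u − a) e^{−itu}`. (Rudnick–Sarnak 1996, (3.11)–(3.12): the explicit formula is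
applied to `h(r/T) T^{−iξr}`, i.e. to a translate-and-twist of `g`.) [cite: RudnickSarnak1996, (3.11)–(3.12)] -/
def slotFn (a t : ℝ) (u : ℝ) : ℂ :=
  g0 (u - a) * cexp (((-(t * u) : ℝ) : ℂ) * I)

/-- `g_{a,t}` is a Weil test function. [folklore] -/
theorem slotFn_isWeilTest (a t : ℝ) : IsWeilTest (slotFn a t) := by
  have h1 : IsWeilTest (weilTranslate g0 a) := g0_isWeilTest.weilTranslate a
  have h2 : ContDiff ℝ ∞ fun u : ℝ ↦ (((-(t * u) : ℝ)) : ℂ) :=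
    Complex.ofRealCLM.contDiff.comp ((contDiff_const.mul contDiff_id).neg)
  have h3 : ContDiff ℝ ∞ fun u : ℝ ↦ cexp (((-(t * u) : ℝ) : ℂ) * I) :=
    Complex.contDiff_exp.comp (h2.mul contDiff_const)
  exact ⟨h1.1.mul h3, h1.2.mul_right⟩

/-- `g_{a,t}(0) = g₀(a)`. [folklore] -/
theorem slotFn_zero (a t : ℝ) : slotFn a t 0 = g0 a := by
  simp [slotFn, g0_neg]

/-- **Transform of the slot function**: `ĝ_{a,t}(s) = e^{(s − it − 1/2)a} ĝ₀(s − it)`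
(`weilMellin_weilTranslate` and the twist `e^{−itu} e^{(s−1/2)u} = e^{(s−it−1/2)u}`). [folklore] -/
theorem weilMellin_slotFn (a t : ℝ) (s : ℂ) :
    weilMellin (slotFn a t) s = cexp ((s - t * I - 1 / 2) * a) * weilMellin g0 (s - t * I) := by
  have h := weilMellin_weilTranslate g0 a (s - t * I)
  rw [show (s - t * I - 1 / 2 : ℂ) = (s - t * I) - 1 / 2 by ring, ← h]
  unfold weilMellin slotFn weilTranslate
  congr 1 with u
  rw [mul_assoc, ← Complex.exp_add]
  congr 2
  push_cast
  ring

/-- On the critical line: `ĝ_{a,t}(1/2 + iy) = e^{i(y−t)a} κ(y − t)`. [folklore] -/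
theorem weilMellin_slotFn_half (a t y : ℝ) :
    weilMellin (slotFn a t) (1 / 2 + y * I) = cexp ((((y - t) * a : ℝ) : ℂ) * I) * ker (y - t) := by
  rw [weilMellin_slotFn]
  have e1 : (1 / 2 + (y : ℂ) * I - t * I : ℂ) = 1 / 2 + (((y - t : ℝ) : ℂ)) * I := by
    push_cast; ring
  rw [e1, weilMellin_g0_half]
  congr 1
  · congr 1; push_cast; ring

/-- At `s = 0`: `ĝ_{a,t}(0) = e^{−(it + 1/2)a} ĝ₀(−it)`. [folklore] -/
theorem weilMellin_slotFn_zero (a t : ℝ) :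
    weilMellin (slotFn a t) 0 = cexp ((-(t * I) - 1 / 2) * a) * weilMellin g0 (-(t * I)) := by
  rw [weilMellin_slotFn]; congr 2 <;> ring

/-- At `s = 1`: `ĝ_{a,t}(1) = e^{(1/2 − it)a} ĝ₀(1 − it)`. [folklore] -/
theorem weilMellin_slotFn_one (a t : ℝ) :
    weilMellin (slotFn a t) 1 = cexp ((1 / 2 - t * I) * a) * weilMellin g0 (1 - t * I) := by
  rw [weilMellin_slotFn]; congr 2; ring

/-! ## The windowed sums over zeros -/

/-- `S⁺(a, t) := Σ_n e^{iaγ_n} κ(t − γ_n)`: the zeros `1/2 + iγ_n` (`γ_n = zetaOrdinate n`, with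
multiplicity) windowed by `κ` around `t` and weighted by the frequency `e^{iaγ}`
(Rudnick–Sarnak 1996, (3.11): `Σ_γ h(γ/T) T^{−iγξ}`, here `a = −ξ log T`; Montgomery 1973:
`Σ_γ x^{iγ} w(t − γ)`). [cite: RudnickSarnak1996, (3.11)] -/
def zeroSumPlus (a t : ℝ) : ℂ :=
  ∑' n : ℕ, cexp (((a * zetaOrdinate n : ℝ) : ℂ) * I) * (ker (t - zetaOrdinate n) : ℂ)

/-- `S⁻(a, t) := Σ_n e^{−iaγ_n} κ(t + γ_n)`: the contribution of the conjugate zeros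
`1/2 − iγ_n` (negligible for `t ≥ 0`). [cite: RudnickSarnak1996, (3.11)] -/
def zeroSumMinus (a t : ℝ) : ℂ :=
  ∑' n : ℕ, cexp (((-(a * zetaOrdinate n) : ℝ) : ℂ) * I) * (ker (t + zetaOrdinate n) : ℂ)

/-- `κ(t − γ_n)` is summable over the ordinates (`κ ≤ C/(1+r²)²` and
`Σ_n 1/(1 + (t − γ_n)²) < ∞`, `exists_density_le`). [folklore] -/
theorem summable_ker_sub (t : ℝ) : Summable fun n : ℕ ↦ ker (t - zetaOrdinate n) := by
  obtain ⟨C, hC0, hC⟩ := exists_ker_le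
  obtain ⟨A, -, hA⟩ := exists_density_le
  refine Summable.of_nonneg_of_le (fun n ↦ ker_nonneg _) (fun n ↦ ?_) ((hA t).1.mul_left C)
  refine (hC _).trans ?_
  rw [mul_one_div, div_le_div_iff_of_pos_left hC0 (by positivity) (by positivity)]
  nlinarith [sq_nonneg (t - zetaOrdinate n)]

/-- `κ(t + γ_n)` is summable over the ordinates. [folklore] -/
theorem summable_ker_add (t : ℝ) : Summable fun n : ℕ ↦ ker (t + zetaOrdinate n) := by
  have h := summable_ker_sub (-t)
  refine h.congr fun n ↦ ?_
  rw [← ker_neg]; congr 1; ring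

/-- The terms of `S⁺` are summable. [folklore] -/
theorem summable_zeroSumPlus_term (a t : ℝ) :
    Summable fun n : ℕ ↦ cexp (((a * zetaOrdinate n : ℝ) : ℂ) * I) * (ker (t - zetaOrdinate n) : ℂ) := by
  refine .of_norm_bounded (summable_ker_sub t) fun n ↦ ?_
  rw [norm_mul, Complex.norm_exp_ofReal_mul_I, one_mul, Complex.norm_real,
    Real.norm_of_nonneg (ker_nonneg _)]

/-- The terms of `S⁻` are summable. [folklore] -/
theorem summable_zeroSumMinus_term (a t : ℝ) :
    Summable fun n : ℕ ↦ cexp (((-(a * zetaOrdinate n) : ℝ) : ℂ) * I) * (ker (t + zetaOrdinate n) : ℂ) := by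
  refine .of_norm_bounded (summable_ker_add t) fun n ↦ ?_
  rw [norm_mul, Complex.norm_exp_ofReal_mul_I, one_mul, Complex.norm_real,
    Real.norm_of_nonneg (ker_nonneg _)]

/-- `‖S⁺(a, t)‖ ≤ Σ_n κ(t − γ_n)`. [folklore] -/
theorem norm_zeroSumPlus_le (a t : ℝ) : ‖zeroSumPlus a t‖ ≤ ∑' n : ℕ, ker (t - zetaOrdinate n) := by
  refine tsum_of_norm_bounded (summable_ker_sub t).hasSum fun n ↦ ?_
  rw [norm_mul, Complex.norm_exp_ofReal_mul_I, one_mul, Complex.norm_real,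
    Real.norm_of_nonneg (ker_nonneg _)]

/-- `‖S⁻(a, t)‖ ≤ Σ_n κ(t + γ_n)`. [folklore] -/
theorem norm_zeroSumMinus_le (a t : ℝ) : ‖zeroSumMinus a t‖ ≤ ∑' n : ℕ, ker (t + zetaOrdinate n) := by
  refine tsum_of_norm_bounded (summable_ker_add t).hasSum fun n ↦ ?_
  rw [norm_mul, Complex.norm_exp_ofReal_mul_I, one_mul, Complex.norm_real,
    Real.norm_of_nonneg (ker_nonneg _)]

/-! ## The prime and archimedean terms of one slot -/

/-- The prime-side Dirichlet polynomial of one slot,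
`𝒜(a, t) := Σ_n Λ(n) n^{−1/2} [g₀(log n − a) e^{−it log n} + g₀(log n + a) e^{it log n}]`
(a finite sum: `|log n ∓ a| < 1/4`). (Rudnick–Sarnak 1996, (3.14)–(3.15): `S_j^±`.)
[cite: RudnickSarnak1996, (3.14)–(3.15)] -/
def primePoly (a t : ℝ) : ℂ :=
  ∑' n : ℕ, ((Λ n : ℝ) : ℂ) / (Real.sqrt n : ℂ) *
    (g0 (Real.log n - a) * cexp (((-(t * Real.log n) : ℝ) : ℂ) * I) +
      g0 (Real.log n + a) * cexp (((t * Real.log n : ℝ) : ℂ) * I))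

/-- The archimedean term of one slot,
`𝒟(a, t) := (1/2π) ∫ e^{ias} κ(s) Re ψ(1/4 + i(s + t)/2) ds − g₀(a) log π`.
(Rudnick–Sarnak 1996, (3.16)–(3.18): `h(∞, r)`, `g_T`.) [cite: RudnickSarnak1996, (3.16)–(3.18)] -/
def archTerm (a t : ℝ) : ℂ :=
  (1 / (2 * π) : ℂ) * (∫ s : ℝ, cexp (((a * s : ℝ) : ℂ) * I) * (ker s : ℂ) * (reDigammaQuarter (s + t) : ℂ)) -
    g0 a * (Real.log π : ℂ)

/-- The prime term of the explicit formula for `g_{a,t}` is `𝒜(a, t)`. [folklore] -/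
theorem weilPrimeTerm_slotFn (a t : ℝ) : weilPrimeTerm (slotFn a t) = primePoly a t := by
  unfold weilPrimeTerm primePoly
  refine tsum_congr fun n ↦ ?_
  have e1 : slotFn a t (Real.log n) = g0 (Real.log n - a) * cexp ((((-(t * Real.log n)) : ℝ) : ℂ) * I) := rfl
  have e2 : slotFn a t (-Real.log n) = g0 (Real.log n + a) * cexp (((t * Real.log n : ℝ) : ℂ) * I) := by
    simp only [slotFn]
    rw [show -Real.log n - a = -(Real.log n + a) by ring, g0_neg]
    congr 2
    push_cast
    ring
  rw [e1, e2]

/-- The archimedean term of the explicit formula for `g_{a,t}` is `𝒟(a, t)` (substitute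
`r = s + t` in `∫ ĝ(1/2 + ir) Re ψ(1/4 + ir/2) dr`). [folklore] -/
theorem weilArchTerm_slotFn (a t : ℝ) : weilArchTerm (slotFn a t) = archTerm a t := by
  rw [weilArchTerm, archTerm, slotFn_zero, weilArchIntegral]
  congr 2
  have h := integral_add_right_eq_self (μ := (volume : Measure ℝ))
    (fun r : ℝ ↦ weilMellin (slotFn a t) (1 / 2 + r * I) *
      ((Complex.digamma (1 / 4 + r / 2 * I)).re : ℂ)) t
  rw [← h]
  congr 1 with s
  rw [weilMellin_slotFn_half, show s + t - t = s by ring, mul_comm s a]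
  rfl

/-! ## The explicit formula for one slot -/

/-- Under RH every non-trivial zero is `1/2 + i Im ρ`. [folklore] -/
theorem eq_half_add_im_of_RH (hRH : RiemannHypothesis) {ρ : ℂ}
    (hρ : ρ ∈ ZetaZeros.riemannZetaNontrivialZeros) : ρ = 1 / 2 + ρ.im * I := by
  have hre : ρ.re = 1 / 2 := by
    refine hRH ρ (ZetaZeros.riemannZetaNontrivialZeros.zeta_eq_zero hρ) ?_
      (ZetaZeros.riemannZetaNontrivialZeros.ne_one hρ)
    rintro ⟨n, hn⟩
    have := ZetaZeros.riemannZetaNontrivialZeros.re_pos hρ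
    rw [hn] at this
    simp at this
    linarith [(n.cast_nonneg : (0 : ℝ) ≤ n)]
  apply Complex.ext <;> simp [hre]

/-- **The explicit formula for the slot function, over the ordinates** (RH): with
`G(y) = ĝ_{a,t}(1/2 + iy)`, `Σ_n (G(γ_n) + G(−γ_n)) = W(g_{a,t})`
(`explicit_formula_holds`, absolute convergence `summable_norm_zeroSide`, and the dictionary
`tsum_nontrivialZeros_eq_tsum_zetaOrdinate`). (Rudnick–Sarnak 1996, Prop. 2.1 / (2.13) for `ζ`.)
[cite: RudnickSarnak1996, Prop. 2.1] -/
theorem tsum_weilMellin_slotFn_eq (hRH : RiemannHypothesis) (a t : ℝ) :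
    ∑' n : ℕ, (weilMellin (slotFn a t) (1 / 2 + zetaOrdinate n * I) +
        weilMellin (slotFn a t) (1 / 2 + ((-zetaOrdinate n : ℝ) : ℂ) * I)) =
      weilFunctional (slotFn a t) := by
  set g := slotFn a t with hg_def
  have hg : IsWeilTest g := slotFn_isWeilTest a t
  -- the zero side as an absolutely convergent sum over the zero set
  have hsum := summable_norm_zeroSide hg
  have h1 : HasWeilZeroSide g (∑' ρ : ZetaZeros.riemannZetaNontrivialZeros,
      (riemannZetaZeroOrder (ρ : ℂ) : ℂ) * weilMellin g ρ) := hasWeilZeroSide_tsum hsum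
  have h2 : HasWeilZeroSide g (weilFunctional g) := explicit_formula_holds hg
  have hZ := tendsto_nhds_unique h1 h2
  -- under RH, `ĝ(ρ) = G(Im ρ)`
  set G : ℝ → ℂ := fun y ↦ weilMellin g (1 / 2 + y * I) with hG
  have hρ : ∀ ρ : ZetaZeros.riemannZetaNontrivialZeros, weilMellin g ρ = G (ρ : ℂ).im := by
    intro ρ
    simp only [hG]
    rw [← eq_half_add_im_of_RH hRH ρ.2]
  have hA : Summable fun ρ : ZetaZeros.riemannZetaNontrivialZeros ↦
      (riemannZetaZeroOrder (ρ : ℂ) : ℂ) * G (ρ : ℂ).im :=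
    (hsum.of_norm).congr fun ρ ↦ by rw [hρ]
  have hB : Summable fun n : ℕ ↦ G (zetaOrdinate n) + G (-zetaOrdinate n) := by
    have hP := summable_ker_sub t
    have hM := summable_ker_add t
    refine .of_norm_bounded (g := fun n ↦ ker (t - zetaOrdinate n) + ker (t + zetaOrdinate n))
      (hP.add hM) fun n ↦ ?_
    refine (norm_add_le _ _).trans (add_le_add ?_ ?_)
    · simp only [hG]
      rw [weilMellin_slotFn_half, norm_mul, Complex.norm_exp_ofReal_mul_I, one_mul,
        Complex.norm_real, Real.norm_of_nonneg (ker_nonneg _), ← ker_neg]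
      apply le_of_eq; congr 1; ring
    · simp only [hG]
      rw [show ((-zetaOrdinate n : ℝ) : ℂ) = (((-zetaOrdinate n : ℝ)) : ℂ) from rfl,
        weilMellin_slotFn_half, norm_mul, Complex.norm_exp_ofReal_mul_I, one_mul,
        Complex.norm_real, Real.norm_of_nonneg (ker_nonneg _), ← ker_neg]
      apply le_of_eq; congr 1; ring
  have hdict := tsum_nontrivialZeros_eq_tsum_zetaOrdinate G hA hB
  have hlhs : (∑' ρ : ZetaZeros.riemannZetaNontrivialZeros,
      (riemannZetaZeroOrder (ρ : ℂ) : ℂ) * G (ρ : ℂ).im) =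
      ∑' ρ : ZetaZeros.riemannZetaNontrivialZeros, (riemannZetaZeroOrder (ρ : ℂ) : ℂ) * weilMellin g ρ :=
    tsum_congr fun ρ ↦ by rw [hρ]
  rw [hlhs, hZ] at hdict
  rw [← hdict]

/-- **The explicit formula in one slot** (RH; Rudnick–Sarnak 1996, (3.12)–(3.18) for `ζ`, in
`t`-windowed form): for all real `a, t`,
`S⁺(a,t) + S⁻(a,t) = e^{−a/2} ĝ₀(−it) + e^{a/2} ĝ₀(1 − it) + e^{iat}(𝒟(a,t) − 𝒜(a,t))`.
[cite: RudnickSarnak1996, (3.12)–(3.18)] -/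
theorem zeroSumPlus_add_zeroSumMinus (hRH : RiemannHypothesis) (a t : ℝ) :
    zeroSumPlus a t + zeroSumMinus a t =
      (Real.exp (-(a / 2)) : ℂ) * weilMellin g0 (-(t * I)) +
        (Real.exp (a / 2) : ℂ) * weilMellin g0 (1 - t * I) +
        cexp (((t * a : ℝ) : ℂ) * I) * (archTerm a t - primePoly a t) := by
  have key := tsum_weilMellin_slotFn_eq hRH a t
  -- multiply the formula by `e^{iat}` and identify the zero side
  have hzero : cexp (((t * a : ℝ) : ℂ) * I) *
      (∑' n : ℕ, (weilMellin (slotFn a t) (1 / 2 + zetaOrdinate n * I) +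
        weilMellin (slotFn a t) (1 / 2 + ((-zetaOrdinate n : ℝ) : ℂ) * I))) =
      zeroSumPlus a t + zeroSumMinus a t := by
    rw [← tsum_mul_left, zeroSumPlus, zeroSumMinus,
      ← (summable_zeroSumPlus_term a t).tsum_add (summable_zeroSumMinus_term a t)]
    refine tsum_congr fun n ↦ ?_
    set γ := zetaOrdinate n
    have h1 : cexp (((t * a : ℝ) : ℂ) * I) * (cexp ((((γ - t) * a : ℝ) : ℂ) * I) * (ker (γ - t) : ℂ)) =
        cexp (((a * γ : ℝ) : ℂ) * I) * (ker (t - γ) : ℂ) := by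
      rw [← mul_assoc, ← Complex.exp_add, ← ker_neg (γ - t), neg_sub]
      congr 2
      push_cast
      ring
    have h2 : cexp (((t * a : ℝ) : ℂ) * I) * (cexp ((((-γ - t) * a : ℝ) : ℂ) * I) * (ker (-γ - t) : ℂ)) =
        cexp (((-(a * γ) : ℝ) : ℂ) * I) * (ker (t + γ) : ℂ) := by
      rw [← mul_assoc, ← Complex.exp_add, show -γ - t = -(t + γ) by ring, ker_neg]
      congr 2
      push_cast
      ring
    rw [weilMellin_slotFn_half, weilMellin_slotFn_half, mul_add, h1, h2]
  rw [← hzero, key, weilFunctional, weilPolarTerm, weilPrimeTerm_slotFn, weilArchTerm_slotFn,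
    weilMellin_slotFn_zero, weilMellin_slotFn_one]
  have e1 : cexp (((t * a : ℝ) : ℂ) * I) * cexp ((-(t * I) - 1 / 2) * a) = (Real.exp (-(a / 2)) : ℂ) := by
    rw [← Complex.exp_add, Complex.ofReal_exp]
    congr 1; push_cast; ring
  have e2 : cexp (((t * a : ℝ) : ℂ) * I) * cexp ((1 / 2 - t * I) * a) = (Real.exp (a / 2) : ℂ) := by
    rw [← Complex.exp_add, Complex.ofReal_exp]
    congr 1; push_cast; ring
  calc cexp (((t * a : ℝ) : ℂ) * I) *
        (cexp ((-(t * I) - 1 / 2) * a) * weilMellin g0 (-(t * I)) +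
          cexp ((1 / 2 - t * I) * a) * weilMellin g0 (1 - t * I) - primePoly a t + archTerm a t)
      = cexp (((t * a : ℝ) : ℂ) * I) * cexp ((-(t * I) - 1 / 2) * a) * weilMellin g0 (-(t * I)) +
          cexp (((t * a : ℝ) : ℂ) * I) * cexp ((1 / 2 - t * I) * a) * weilMellin g0 (1 - t * I) +
          cexp (((t * a : ℝ) : ℂ) * I) * (archTerm a t - primePoly a t) := by ring
    _ = _ := by rw [e1, e2]

end RudnickSarnakN

end Literature.NumberTheory.LFunctions

end
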